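import Literature.Computability.AlgebraicComplexity.PrattTrapezoidVal
import Literature.Combinatorics.Additive.TripleProductProperty
import HarnessLib

/-!
# Pratt 2024, Proposition 3.3 proved: STPP constructions bound `Val(G)` from below

K. Pratt, *On generalized corners and matrix multiplication*, ITCS 2024 = arXiv:2309.03878
[Pratt2024], §2 (Def. 2.1, Prop. 2.6) and §3 (Prop. 3.1, Def. 3.2, Prop. 3.3), read from the held
text (pp. 5, 7).  This file is the first step of the discharge of the named fact
`pratt2024_thm47` (Thm. 4.7, `PrattTrapezoidVal.lean`); everything here is PROVED.

* `sum_card_mul_le_prattVal_of_addSimultaneousTPP` — **Prop. 3.3 with Prop. 2.6**: if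
  `(Aᵢ, Bᵢ, Cᵢ)ᵢ` is an STPP family (the tree's `AddSimultaneousTPP`, CKSU 2005 Def. 5.1) in a
  finite abelian group `K`, then `Σᵢ |Aᵢ||Bᵢ||Cᵢ| ≤ Val(K)`.  Printed proof: the sets
  `⊔ᵢ AᵢBᵢ⁻¹, ⊔ᵢ BᵢCᵢ⁻¹, ⊔ᵢ CᵢAᵢ⁻¹` induce a disjoint union of matrix multiplication hypergraphs
  (Prop. 2.6), which satisfies the constraints of Def. 3.2 (second half of the proof of Prop. 3.1)
  and has `Σᵢ |Aᵢ||Bᵢ||Cᵢ|` hyperedges.  Here, additively: `𝔄 = ⋃ᵢ (Aᵢ - Bᵢ)`, `𝔅 = ⋃ᵢ (Bᵢ - Cᵢ)`,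
  `ℭ = ⋃ᵢ (Cᵢ - Aᵢ)`; the three uniqueness constraints of Def. 3.2 and the injectivity of
  `(i, a, b, c) ↦ (a - b, b - c, c - a)` all follow from the one-clause form of the STPP
  (`addSimultaneousTPP_iff_forall`) through the single rearrangement lemma
  `addSimultaneousTPP_rearrange`.
* `addSimultaneousTPP_image_of_reflect`, `injective_of_reflect` — the transport step of the
  proofs of Thm. 4.4 / Thm. 4.7 ("the image of sets satisfying the STPP under this map still
  satisfy the STPP"): an STPP family stays STPP under ANY map `φ : K → K'` that reflects sums of
  three elements (`φ a + φ b + φ c = φ a' + φ b' + φ c' → a + b + c = a' + b' + c'`); such a map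
  is injective.
* `exists_freiman3_pi_zmod`, `exists_freiman3_prod`, `exists_freiman3_of_addEquiv`,
  `exists_freiman3_triple_of_addEquiv` — the mixed-radix map of the proofs of Thm. 4.4 / 4.7
  ("the map from `G³ = ℤ_{m₁} × ⋯ × ℤ_{m_k}` to `G' := ℤ_{∏ᵢ 3mᵢ}` sending `(x₁, …, x_k)` to
  `x₁ + (3m₁)x₂ + (3m₁)(3m₂)x₃ + ⋯`") as an ℕ-valued map `ψ` whose three-fold sums are
  `< 3^k ∏ mᵢ` (resp. `< (3^k |K|)^3` on `K³`) and which reflects three-fold sums, built by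
  peeling off one cyclic factor at a time (residue and quotient modulo `3m₁`);
* `sum_card_mul_le_prattVal_zmod_of_reflect`, `sum_card_mul_le_prattVal_zmod_of_addEquiv` — the
  two steps assembled: an STPP family `(Aᵥ, Bᵥ, Cᵥ)ᵥ` in `K³`, `K ≃ ∏_{i<k} ℤ/mᵢ`, gives
  `Σᵥ |Aᵥ||Bᵥ||Cᵥ| ≤ Val(ℤ/Nℤ)` for every `N ≥ (3^k |K|)^3`.

## References

* [Pratt2024] K. Pratt, arXiv:2309.03878: Def. 2.1, Prop. 2.6 (p. 5), Prop. 3.1, Def. 3.2,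
  Prop. 3.3 (p. 7), proofs of Thm. 4.4 and Thm. 4.7 (pp. 9–10).
* [CohnKleinbergSzegedyUmans2005] Def. 5.1 (the STPP; tree: `AddSimultaneousTPP`).
-/

namespace Literature.Computability.AlgebraicComplexity

open Finset Literature.Combinatorics.Additive

section Rearrange

variable {K : Type*} [AddCommGroup K] {ι : Type*} {A B C : ι → Finset K}

/-- The one-clause STPP (BCCGNSU Def. 2.2, tree lemma `addSimultaneousTPP_iff_forall`) read on a
relation `(s₀ - t₀) + (t₁ - u₁) + (u₂ - s₂) = 0` between an element of `Aᵢ - Bᵢ`, one of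
`Bⱼ - Cⱼ` and one of `C_k - A_k`: the indices coincide and `s₂ = s₀`, `t₀ = t₁`, `u₁ = u₂`
(this is the computation behind "the only hyperedges … are between sets of the form
`A_i, B_i, C_i`" in the proof of Pratt's Prop. 2.6). [cite: Pratt2024, Prop. 2.6 (proof)] -/
theorem addSimultaneousTPP_rearrange (hS : AddSimultaneousTPP A B C) {i j k : ι}
    {s₀ s₂ t₀ t₁ u₁ u₂ : K} (hs₀ : s₀ ∈ A i) (ht₀ : t₀ ∈ B i) (ht₁ : t₁ ∈ B j) (hu₁ : u₁ ∈ C j)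
    (hu₂ : u₂ ∈ C k) (hs₂ : s₂ ∈ A k) (h : (s₀ - t₀) + (t₁ - u₁) + (u₂ - s₂) = 0) :
    i = j ∧ j = k ∧ s₂ = s₀ ∧ t₀ = t₁ ∧ u₁ = u₂ :=
  (addSimultaneousTPP_iff_forall A B C).1 hS i j k s₂ hs₂ s₀ hs₀ t₀ ht₀ t₁ ht₁ u₁ hu₁ u₂ hu₂
    (by rw [← h]; abel)

/-- First constraint of Pratt's Def. 3.2 for the triple `(⋃(Aᵢ-Bᵢ), ⋃(Bᵢ-Cᵢ), ⋃(Cᵢ-Aᵢ))` of an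
STPP family, element form: with `a' = s₀ - t₀` and `b' = t₁ - u₁` fixed, a solution
`(a, b, c) = (s - t, t₂ - u₂, u₃ - s₃)` of `0 = a' + b + c = a + b' + c` is forced to be
`(s₀ - t₁, t₀ - u₁, u₁ - s₀)`. [cite: Pratt2024, Def. 3.2 and Prop. 3.3 (proof)] -/
theorem addSimultaneousTPP_constraint₁ (hS : AddSimultaneousTPP A B C) {i i' l j k : ι}
    {s₀ t₀ t₁ u₁ s t t₂ u₂ u₃ s₃ : K} (hs₀ : s₀ ∈ A i) (ht₀ : t₀ ∈ B i) (ht₁ : t₁ ∈ B i')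
    (hu₁ : u₁ ∈ C i') (hs : s ∈ A l) (ht : t ∈ B l) (ht₂ : t₂ ∈ B j) (hu₂ : u₂ ∈ C j)
    (hu₃ : u₃ ∈ C k) (hs₃ : s₃ ∈ A k) (h1 : (s₀ - t₀) + (t₂ - u₂) + (u₃ - s₃) = 0)
    (h2 : (s - t) + (t₁ - u₁) + (u₃ - s₃) = 0) :
    s - t = s₀ - t₁ ∧ t₂ - u₂ = t₀ - u₁ ∧ u₃ - s₃ = u₁ - s₀ := by
  obtain ⟨rfl, rfl, rfl, rfl, rfl⟩ := addSimultaneousTPP_rearrange hS hs₀ ht₀ ht₂ hu₂ hu₃ hs₃ h1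
  obtain ⟨rfl, -, h3, rfl, rfl⟩ := addSimultaneousTPP_rearrange hS hs ht ht₁ hu₁ hu₃ hs₃ h2
  rw [h3]
  exact ⟨rfl, rfl, rfl⟩

/-- Second constraint of Pratt's Def. 3.2, element form: with `a' = s₀ - t₀` and `c' = u₁ - s₁`
fixed, a solution `(a, b, c) = (s - t, t₂ - u₂, u₃ - s₃)` of `0 = a' + b + c = a + b + c'` is
forced to be `(s₁ - t₀, t₀ - u₁, u₁ - s₀)`. [cite: Pratt2024, Def. 3.2 and Prop. 3.3 (proof)] -/
theorem addSimultaneousTPP_constraint₂ (hS : AddSimultaneousTPP A B C) {i i' l j k : ι}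
    {s₀ t₀ u₁ s₁ s t t₂ u₂ u₃ s₃ : K} (hs₀ : s₀ ∈ A i) (ht₀ : t₀ ∈ B i) (hu₁ : u₁ ∈ C i')
    (hs₁ : s₁ ∈ A i') (hs : s ∈ A l) (ht : t ∈ B l) (ht₂ : t₂ ∈ B j) (hu₂ : u₂ ∈ C j)
    (hu₃ : u₃ ∈ C k) (hs₃ : s₃ ∈ A k) (h1 : (s₀ - t₀) + (t₂ - u₂) + (u₃ - s₃) = 0)
    (h2 : (s - t) + (t₂ - u₂) + (u₁ - s₁) = 0) :
    s - t = s₁ - t₀ ∧ t₂ - u₂ = t₀ - u₁ ∧ u₃ - s₃ = u₁ - s₀ := by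
  obtain ⟨rfl, rfl, rfl, rfl, rfl⟩ := addSimultaneousTPP_rearrange hS hs₀ ht₀ ht₂ hu₂ hu₃ hs₃ h1
  obtain ⟨rfl, -, rfl, h3, rfl⟩ := addSimultaneousTPP_rearrange hS hs ht ht₂ hu₂ hu₁ hs₁ h2
  rw [h3]
  exact ⟨rfl, rfl, rfl⟩

/-- Third constraint of Pratt's Def. 3.2, element form: with `b' = t₁ - u₁` and `c' = u₄ - s₄`
fixed, a solution `(a, b, c) = (s - t, t₂ - u₂, u₃ - s₃)` of `0 = a + b' + c = a + b + c'` is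
forced to be `(s₄ - t₁, t₁ - u₄, u₁ - s₄)`. [cite: Pratt2024, Def. 3.2 and Prop. 3.3 (proof)] -/
theorem addSimultaneousTPP_constraint₃ (hS : AddSimultaneousTPP A B C) {i' i'' l j k : ι}
    {t₁ u₁ u₄ s₄ s t t₂ u₂ u₃ s₃ : K} (ht₁ : t₁ ∈ B i') (hu₁ : u₁ ∈ C i') (hu₄ : u₄ ∈ C i'')
    (hs₄ : s₄ ∈ A i'') (hs : s ∈ A l) (ht : t ∈ B l) (ht₂ : t₂ ∈ B j) (hu₂ : u₂ ∈ C j)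
    (hu₃ : u₃ ∈ C k) (hs₃ : s₃ ∈ A k) (h1 : (s - t) + (t₁ - u₁) + (u₃ - s₃) = 0)
    (h2 : (s - t) + (t₂ - u₂) + (u₄ - s₄) = 0) :
    s - t = s₄ - t₁ ∧ t₂ - u₂ = t₁ - u₄ ∧ u₃ - s₃ = u₁ - s₄ := by
  obtain ⟨rfl, rfl, rfl, rfl, rfl⟩ := addSimultaneousTPP_rearrange hS hs ht ht₁ hu₁ hu₃ hs₃ h1
  obtain ⟨rfl, -, rfl, rfl, rfl⟩ := addSimultaneousTPP_rearrange hS hs ht ht₂ hu₂ hu₄ hs₄ h2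
  exact ⟨rfl, rfl, rfl⟩

/-- Disjointness/injectivity behind Prop. 2.6 ("the second condition implies that `A_i` and
`A_j` are disjoint when `i ≠ j`" together with the TPP): `a - b = a' - b'` with `a ∈ Aᵢ, b ∈ Bᵢ,
a' ∈ Aᵢ', b' ∈ Bᵢ'` forces `i = i'`, `a = a'`, `b = b'`, provided some `Cᵢ'` element exists.
[cite: Pratt2024, Prop. 2.6 (proof)] -/
theorem addSimultaneousTPP_sub_inj (hS : AddSimultaneousTPP A B C) {i i' : ι} {a b a' b' c' : K}
    (ha : a ∈ A i) (hb : b ∈ B i) (ha' : a' ∈ A i') (hb' : b' ∈ B i') (hc' : c' ∈ C i')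
    (h : a - b = a' - b') : i = i' ∧ a = a' ∧ b = b' := by
  obtain ⟨rfl, -, h1, h2, -⟩ := (addSimultaneousTPP_iff_forall A B C).1 hS i i' i' a' ha' a ha b hb
    b' hb' c' hc' c' hc' (by
      have e : a - a' + (b' - b) = (a - b) - (a' - b') := by abel
      rw [sub_self, add_zero, e, h, sub_self])
  exact ⟨rfl, h1.symm, h2⟩

end Rearrange

section Val

variable {K : Type*} [AddCommGroup K] [DecidableEq K] {ι : Type*} [Fintype ι] {A B C : ι → Finset K}

/-- Membership in `⋃ᵢ (Aᵢ - Bᵢ)` (the additive `⊔ᵢ AᵢBᵢ⁻¹` of Pratt's Prop. 2.6). [folklore] -/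
theorem mem_biUnion_image_sub {A B : ι → Finset K} {a : K} :
    a ∈ univ.biUnion (fun i => ((A i) ×ˢ (B i)).image fun p : K × K => p.1 - p.2) ↔
      ∃ i, ∃ s ∈ A i, ∃ t ∈ B i, s - t = a := by
  simp only [mem_biUnion, mem_univ, true_and, mem_image, mem_product, Prod.exists]
  constructor
  · rintro ⟨i, s, t, ⟨hs, ht⟩, rfl⟩
    exact ⟨i, s, hs, t, ht, rfl⟩
  · rintro ⟨i, s, hs, t, ht, rfl⟩
    exact ⟨i, s, t, ⟨hs, ht⟩, rfl⟩

/-- **Pratt 2024, Prop. 2.6 with the second half of Prop. 3.1**: for an STPP family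
`(Aᵢ, Bᵢ, Cᵢ)ᵢ` in an abelian group, the triple `(⋃ᵢ (Aᵢ - Bᵢ), ⋃ᵢ (Bᵢ - Cᵢ), ⋃ᵢ (Cᵢ - Aᵢ))` is
equilateral trapezoid-free (Def. 3.2): it induces a disjoint union of matrix multiplication
hypergraphs, and these satisfy the constraints of Prop. 3.1.
[cite: Pratt2024, Prop. 2.6 and Prop. 3.3 (proof)] -/
theorem isEquilateralTrapezoidFree_of_addSimultaneousTPP (hS : AddSimultaneousTPP A B C) :
    IsEquilateralTrapezoidFree
      (univ.biUnion fun i => ((A i) ×ˢ (B i)).image fun p : K × K => p.1 - p.2)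
      (univ.biUnion fun i => ((B i) ×ˢ (C i)).image fun p : K × K => p.1 - p.2)
      (univ.biUnion fun i => ((C i) ×ˢ (A i)).image fun p : K × K => p.1 - p.2) := by
  refine ⟨fun a' ha' b' hb' => ?_, fun a' ha' c' hc' => ?_, fun b' hb' c' hc' => ?_⟩
  · obtain ⟨i, s₀, hs₀, t₀, ht₀, rfl⟩ := mem_biUnion_image_sub.1 ha'
    obtain ⟨i', t₁, ht₁, u₁, hu₁, rfl⟩ := mem_biUnion_image_sub.1 hb'
    refine card_le_one.2 fun x hx y hy => ?_
    have key : ∀ z ∈ ((univ.biUnion fun i => ((A i) ×ˢ (B i)).image fun p : K × K => p.1 - p.2) ×ˢ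
        (univ.biUnion fun i => ((B i) ×ˢ (C i)).image fun p : K × K => p.1 - p.2) ×ˢ
        (univ.biUnion fun i => ((C i) ×ˢ (A i)).image fun p : K × K => p.1 - p.2)).filter
          (fun t : K × K × K => s₀ - t₀ + t.2.1 + t.2.2 = 0 ∧ t.1 + (t₁ - u₁) + t.2.2 = 0),
        z = (s₀ - t₁, t₀ - u₁, u₁ - s₀) := by
      intro z hz
      simp only [mem_filter, mem_product] at hz
      obtain ⟨⟨hz1, hz2, hz3⟩, h1, h2⟩ := hz
      obtain ⟨l, s, hs, t, ht, hzl⟩ := mem_biUnion_image_sub.1 hz1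
      obtain ⟨j, t₂, ht₂, u₂, hu₂, hzj⟩ := mem_biUnion_image_sub.1 hz2
      obtain ⟨k, u₃, hu₃, s₃, hs₃, hzk⟩ := mem_biUnion_image_sub.1 hz3
      rw [← hzj, ← hzk] at h1
      rw [← hzl, ← hzk] at h2
      obtain ⟨e1, e2, e3⟩ :=
        addSimultaneousTPP_constraint₁ hS hs₀ ht₀ ht₁ hu₁ hs ht ht₂ hu₂ hu₃ hs₃ h1 h2
      exact Prod.ext (hzl.symm.trans e1) (Prod.ext (hzj.symm.trans e2) (hzk.symm.trans e3))
    exact (key x hx).trans (key y hy).symm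
  · obtain ⟨i, s₀, hs₀, t₀, ht₀, rfl⟩ := mem_biUnion_image_sub.1 ha'
    obtain ⟨i', u₁, hu₁, s₁, hs₁, rfl⟩ := mem_biUnion_image_sub.1 hc'
    refine card_le_one.2 fun x hx y hy => ?_
    have key : ∀ z ∈ ((univ.biUnion fun i => ((A i) ×ˢ (B i)).image fun p : K × K => p.1 - p.2) ×ˢ
        (univ.biUnion fun i => ((B i) ×ˢ (C i)).image fun p : K × K => p.1 - p.2) ×ˢ
        (univ.biUnion fun i => ((C i) ×ˢ (A i)).image fun p : K × K => p.1 - p.2)).filter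
          (fun t : K × K × K => s₀ - t₀ + t.2.1 + t.2.2 = 0 ∧ t.1 + t.2.1 + (u₁ - s₁) = 0),
        z = (s₁ - t₀, t₀ - u₁, u₁ - s₀) := by
      intro z hz
      simp only [mem_filter, mem_product] at hz
      obtain ⟨⟨hz1, hz2, hz3⟩, h1, h2⟩ := hz
      obtain ⟨l, s, hs, t, ht, hzl⟩ := mem_biUnion_image_sub.1 hz1
      obtain ⟨j, t₂, ht₂, u₂, hu₂, hzj⟩ := mem_biUnion_image_sub.1 hz2
      obtain ⟨k, u₃, hu₃, s₃, hs₃, hzk⟩ := mem_biUnion_image_sub.1 hz3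
      rw [← hzj, ← hzk] at h1
      rw [← hzl, ← hzj] at h2
      obtain ⟨e1, e2, e3⟩ :=
        addSimultaneousTPP_constraint₂ hS hs₀ ht₀ hu₁ hs₁ hs ht ht₂ hu₂ hu₃ hs₃ h1 h2
      exact Prod.ext (hzl.symm.trans e1) (Prod.ext (hzj.symm.trans e2) (hzk.symm.trans e3))
    exact (key x hx).trans (key y hy).symm
  · obtain ⟨i', t₁, ht₁, u₁, hu₁, rfl⟩ := mem_biUnion_image_sub.1 hb'
    obtain ⟨i'', u₄, hu₄, s₄, hs₄, rfl⟩ := mem_biUnion_image_sub.1 hc'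
    refine card_le_one.2 fun x hx y hy => ?_
    have key : ∀ z ∈ ((univ.biUnion fun i => ((A i) ×ˢ (B i)).image fun p : K × K => p.1 - p.2) ×ˢ
        (univ.biUnion fun i => ((B i) ×ˢ (C i)).image fun p : K × K => p.1 - p.2) ×ˢ
        (univ.biUnion fun i => ((C i) ×ˢ (A i)).image fun p : K × K => p.1 - p.2)).filter
          (fun t : K × K × K => t.1 + (t₁ - u₁) + t.2.2 = 0 ∧ t.1 + t.2.1 + (u₄ - s₄) = 0),
        z = (s₄ - t₁, t₁ - u₄, u₁ - s₄) := by
      intro z hz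
      simp only [mem_filter, mem_product] at hz
      obtain ⟨⟨hz1, hz2, hz3⟩, h1, h2⟩ := hz
      obtain ⟨l, s, hs, t, ht, hzl⟩ := mem_biUnion_image_sub.1 hz1
      obtain ⟨j, t₂, ht₂, u₂, hu₂, hzj⟩ := mem_biUnion_image_sub.1 hz2
      obtain ⟨k, u₃, hu₃, s₃, hs₃, hzk⟩ := mem_biUnion_image_sub.1 hz3
      rw [← hzl, ← hzk] at h1
      rw [← hzl, ← hzj] at h2
      obtain ⟨e1, e2, e3⟩ :=
        addSimultaneousTPP_constraint₃ hS ht₁ hu₁ hu₄ hs₄ hs ht ht₂ hu₂ hu₃ hs₃ h1 h2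
      exact Prod.ext (hzl.symm.trans e1) (Prod.ext (hzj.symm.trans e2) (hzk.symm.trans e3))
    exact (key x hx).trans (key y hy).symm

/-- Counting half of **Pratt 2024, Prop. 3.3**: the map `(i, a, b, c) ↦ (a - b, b - c, c - a)`
injects `⨆ᵢ Aᵢ × Bᵢ × Cᵢ` into the solutions of `x + y + z = 0` on
`(⋃ᵢ (Aᵢ - Bᵢ)) × (⋃ᵢ (Bᵢ - Cᵢ)) × (⋃ᵢ (Cᵢ - Aᵢ))`, so there are at least `Σᵢ |Aᵢ||Bᵢ||Cᵢ|`
solutions ("`M_{nᵢ,mᵢ,pᵢ}` … contains `nᵢmᵢpᵢ` hyperedges"). [cite: Pratt2024, Prop. 3.3 (proof)] -/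
theorem sum_card_mul_le_card_zeroSumTriples (hS : AddSimultaneousTPP A B C) :
    ∑ i, #(A i) * #(B i) * #(C i) ≤ #(zeroSumTriples
      (univ.biUnion fun i => ((A i) ×ˢ (B i)).image fun p : K × K => p.1 - p.2)
      (univ.biUnion fun i => ((B i) ×ˢ (C i)).image fun p : K × K => p.1 - p.2)
      (univ.biUnion fun i => ((C i) ×ˢ (A i)).image fun p : K × K => p.1 - p.2)) := by
  classical
  set D : Finset (Σ _ : ι, K × K × K) := univ.sigma fun i => A i ×ˢ B i ×ˢ C i with hD
  set Φ : (Σ _ : ι, K × K × K) → K × K × K :=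
    fun x => (x.2.1 - x.2.2.1, x.2.2.1 - x.2.2.2, x.2.2.2 - x.2.1) with hΦ
  have hmemD : ∀ x : Σ _ : ι, K × K × K, x ∈ D ↔
      x.2.1 ∈ A x.1 ∧ x.2.2.1 ∈ B x.1 ∧ x.2.2.2 ∈ C x.1 := by
    rintro ⟨i, a, b, c⟩
    simp [hD]
  have hinj : Set.InjOn Φ ↑D := by
    rintro ⟨i, a, b, c⟩ hx ⟨i', a', b', c'⟩ hy he
    rw [Finset.mem_coe, hmemD] at hx hy
    simp only [hΦ, Prod.mk.injEq] at he
    obtain ⟨rfl, rfl, rfl⟩ := addSimultaneousTPP_sub_inj hS hx.1 hx.2.1 hy.1 hy.2.1 hy.2.2 he.1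
    have hc : c = c' := sub_right_injective he.2.1
    rw [hc]
  have hsub : D.image Φ ⊆ zeroSumTriples
      (univ.biUnion fun i => ((A i) ×ˢ (B i)).image fun p : K × K => p.1 - p.2)
      (univ.biUnion fun i => ((B i) ×ˢ (C i)).image fun p : K × K => p.1 - p.2)
      (univ.biUnion fun i => ((C i) ×ˢ (A i)).image fun p : K × K => p.1 - p.2) := by
    intro t ht
    obtain ⟨⟨i, a, b, c⟩, hx, rfl⟩ := mem_image.1 ht
    rw [hmemD] at hx
    rw [mem_zeroSumTriples]
    refine ⟨⟨mem_biUnion_image_sub.2 ⟨i, a, hx.1, b, hx.2.1, rfl⟩,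
      mem_biUnion_image_sub.2 ⟨i, b, hx.2.1, c, hx.2.2, rfl⟩,
      mem_biUnion_image_sub.2 ⟨i, c, hx.2.2, a, hx.1, rfl⟩⟩, ?_⟩
    simp only [hΦ]
    abel
  calc ∑ i, #(A i) * #(B i) * #(C i) = #D := by
        rw [hD, card_sigma]
        simp only [card_product, mul_assoc]
    _ = #(D.image Φ) := (card_image_of_injOn hinj).symm
    _ ≤ _ := card_le_card hsub

/-- **Pratt 2024, Proposition 3.3** ("Suppose that `X_G` contains disjoint induced subhypergraphs
`M_{nᵢ,mᵢ,pᵢ}`. Then `Val(G) ≥ Σᵢ nᵢmᵢpᵢ`"), in the STPP form supplied by Prop. 2.6: for an STPP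
family `(Aᵢ, Bᵢ, Cᵢ)ᵢ` (CKSU Def. 5.1, tree `AddSimultaneousTPP`) in a finite abelian group `K`,
`Σᵢ |Aᵢ||Bᵢ||Cᵢ| ≤ Val(K)`. [cite: Pratt2024, Prop. 3.3] -/
theorem sum_card_mul_le_prattVal_of_addSimultaneousTPP [Fintype K]
    (hS : AddSimultaneousTPP A B C) : ∑ i, #(A i) * #(B i) * #(C i) ≤ prattVal K :=
  (sum_card_mul_le_card_zeroSumTriples hS).trans
    (card_zeroSumTriples_le_prattVal (isEquilateralTrapezoidFree_of_addSimultaneousTPP hS))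

end Val

/-! ### Transport of STPP families along maps reflecting three-fold sums -/

section Transport

variable {K K' : Type*} [AddCommGroup K] [AddCommGroup K'] [DecidableEq K'] {ι : Type*}
  {A B C : ι → Finset K}

omit [DecidableEq K'] in
/-- A map reflecting sums of three elements is injective. [folklore] -/
theorem injective_of_reflect (φ : K → K')
    (hφ : ∀ a b c a' b' c', φ a + φ b + φ c = φ a' + φ b' + φ c' → a + b + c = a' + b' + c') :
    Function.Injective φ := by
  intro a a' h
  have h3 : a + a + a = a' + a + a := hφ a a a a' a a (by rw [h])
  exact add_right_cancel (add_right_cancel h3)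

/-- **Transport of the STPP** (the step "the image of sets satisfying the STPP under this map
still satisfy the STPP" in the proofs of Pratt's Thm. 4.4 and Thm. 4.7, there for the mixed-radix
map `ℤ_{m₁} × ⋯ × ℤ_{m_k} → ℤ_{∏ 3mᵢ}`): an STPP family stays an STPP family under any map
`φ : K → K'` of abelian groups which reflects sums of three elements,
`φ a + φ b + φ c = φ a' + φ b' + φ c' → a + b + c = a' + b' + c'`.
[cite: Pratt2024, Thm. 4.7 (proof)] -/
theorem addSimultaneousTPP_image_of_reflect (hS : AddSimultaneousTPP A B C) (φ : K → K')
    (hφ : ∀ a b c a' b' c', φ a + φ b + φ c = φ a' + φ b' + φ c' → a + b + c = a' + b' + c') :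
    AddSimultaneousTPP (fun i => (A i).image φ) (fun i => (B i).image φ)
      (fun i => (C i).image φ) := by
  rw [addSimultaneousTPP_iff_forall] at hS ⊢
  intro i j k s hs s' hs' t ht t' ht' u hu u' hu' he
  obtain ⟨a, ha, rfl⟩ := mem_image.1 hs
  obtain ⟨a', ha', rfl⟩ := mem_image.1 hs'
  obtain ⟨b, hb, rfl⟩ := mem_image.1 ht
  obtain ⟨b', hb', rfl⟩ := mem_image.1 ht'
  obtain ⟨c, hc, rfl⟩ := mem_image.1 hu
  obtain ⟨c', hc', rfl⟩ := mem_image.1 hu'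
  have he' : φ a' + φ b' + φ c' = φ a + φ b + φ c := by
    rw [← sub_eq_zero, ← he]; abel
  have h3 := hφ _ _ _ _ _ _ he'
  obtain ⟨hij, hjk, h1, h2, h3⟩ := hS i j k a ha a' ha' b hb b' hb' c hc c' hc'
    (by rw [← sub_eq_zero] at h3; rw [← h3]; abel)
  exact ⟨hij, hjk, by rw [h1], by rw [h2], by rw [h3]⟩

end Transport

/-! ### The mixed-radix map `ℤ_{m₁} × ⋯ × ℤ_{m_k} → ℕ` reflecting three-fold sums -/

section Freiman

/-- **The mixed-radix embedding of the proofs of Pratt's Thm. 4.4 / Thm. 4.7** ("the map from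
`ℤ_{m₁} × ⋯ × ℤ_{m_k}` to `ℤ_{∏ᵢ 3mᵢ}` sending `(x₁, …, x_k)` to
`x₁ + (3m₁)x₂ + (3m₁)(3m₂)x₃ + ⋯`"; "since `Σ yᵢ (3q)^{i-1}` has a unique such expression … when
`yᵢ < 3q`, it follows that `a₁+a₂+a₃ ≠ a₄+a₅+a₆ ⟹ φ(a₁)+φ(a₂)+φ(a₃) ≠ φ(a₄)+φ(a₅)+φ(a₆)`"), as
an ℕ-valued map built by peeling off one factor at a time: there is `ψ : ∏ᵢ ℤ/mᵢ → ℕ` whose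
three-fold sums are `< 3^k ∏ mᵢ` and which reflects three-fold sums.
[cite: Pratt2024, Thm. 4.7 (proof)] -/
theorem exists_freiman3_pi_zmod : ∀ (k : ℕ) (m : Fin k → ℕ), (∀ i, 0 < m i) →
    ∃ ψ : (Π i, ZMod (m i)) → ℕ, (∀ a b c, ψ a + ψ b + ψ c < 3 ^ k * ∏ i, m i) ∧
      (∀ a b c a' b' c', ψ a + ψ b + ψ c = ψ a' + ψ b' + ψ c' →
        a + b + c = a' + b' + c') := by
  intro k
  induction k with
  | zero =>
    intro m _
    exact ⟨fun _ => 0, fun a b c => by simp, fun a b c a' b' c' _ => Subsingleton.elim _ _⟩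
  | succ k ih =>
    intro m hm
    obtain ⟨ψ', h1', h2'⟩ := ih (fun i => m i.succ) (fun i => hm i.succ)
    haveI : ∀ i, NeZero (m i) := fun i => ⟨(hm i).ne'⟩
    have hm0 : 0 < 3 * m 0 := by have := hm 0; omega
    refine ⟨fun a => (a 0).val + 3 * m 0 * ψ' (fun i => a i.succ), fun a b c => ?_,
      fun a b c a' b' c' h => ?_⟩
    · have hS' := h1' (fun i => a i.succ) (fun i => b i.succ) (fun i => c i.succ)
      have ha := (a 0).val_lt
      have hb := (b 0).val_lt
      have hc := (c 0).val_lt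
      have key : (a 0).val + 3 * m 0 * ψ' (fun i => a i.succ) +
          ((b 0).val + 3 * m 0 * ψ' (fun i => b i.succ)) +
          ((c 0).val + 3 * m 0 * ψ' (fun i => c i.succ)) =
          ((a 0).val + (b 0).val + (c 0).val) + 3 * m 0 *
            (ψ' (fun i => a i.succ) + ψ' (fun i => b i.succ) + ψ' (fun i => c i.succ)) := by ring
      rw [key, Fin.prod_univ_succ, pow_succ]
      calc (a 0).val + (b 0).val + (c 0).val + 3 * m 0 *
            (ψ' (fun i => a i.succ) + ψ' (fun i => b i.succ) + ψ' (fun i => c i.succ))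
          < 3 * m 0 + 3 * m 0 *
            (ψ' (fun i => a i.succ) + ψ' (fun i => b i.succ) + ψ' (fun i => c i.succ)) := by
            apply Nat.add_lt_add_right; omega
        _ = 3 * m 0 *
            (ψ' (fun i => a i.succ) + ψ' (fun i => b i.succ) + ψ' (fun i => c i.succ) + 1) := by
            ring
        _ ≤ 3 * m 0 * (3 ^ k * ∏ i : Fin k, m i.succ) :=
            Nat.mul_le_mul_left _ (Nat.succ_le_of_lt hS')
        _ = 3 ^ k * 3 * (m 0 * ∏ i : Fin k, m i.succ) := by ring
    · -- reflection: split the relation into its residue and quotient modulo `3 m 0`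
      have ha := (a 0).val_lt
      have hb := (b 0).val_lt
      have hc := (c 0).val_lt
      have ha' := (a' 0).val_lt
      have hb' := (b' 0).val_lt
      have hc' := (c' 0).val_lt
      have key : ∀ x y z : Π i, ZMod (m i),
          (x 0).val + 3 * m 0 * ψ' (fun i => x i.succ) +
          ((y 0).val + 3 * m 0 * ψ' (fun i => y i.succ)) +
          ((z 0).val + 3 * m 0 * ψ' (fun i => z i.succ)) =
          ((x 0).val + (y 0).val + (z 0).val) + 3 * m 0 *
            (ψ' (fun i => x i.succ) + ψ' (fun i => y i.succ) + ψ' (fun i => z i.succ)) := by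
        intro x y z; ring
      rw [key, key] at h
      have hV : (a 0).val + (b 0).val + (c 0).val < 3 * m 0 := by omega
      have hV' : (a' 0).val + (b' 0).val + (c' 0).val < 3 * m 0 := by omega
      have hmod := congrArg (· % (3 * m 0)) h
      have hdiv := congrArg (· / (3 * m 0)) h
      simp only [Nat.add_mul_mod_self_left, Nat.mod_eq_of_lt hV, Nat.mod_eq_of_lt hV'] at hmod
      simp only [Nat.add_mul_div_left _ _ hm0, Nat.div_eq_of_lt hV, Nat.div_eq_of_lt hV',
        zero_add] at hdiv
      have htail := h2' _ _ _ _ _ _ hdiv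
      have hhead : a 0 + b 0 + c 0 = a' 0 + b' 0 + c' 0 := by
        have e1 : (((a 0).val + (b 0).val + (c 0).val : ℕ) : ZMod (m 0)) = a 0 + b 0 + c 0 := by
          push_cast; simp only [ZMod.natCast_val, ZMod.cast_id', id_eq]
        have e2 : (((a' 0).val + (b' 0).val + (c' 0).val : ℕ) : ZMod (m 0)) =
            a' 0 + b' 0 + c' 0 := by
          push_cast; simp only [ZMod.natCast_val, ZMod.cast_id', id_eq]
        rw [← e1, ← e2, hmod]
      funext i
      refine Fin.cases ?_ (fun i => ?_) i
      · simpa only [Pi.add_apply] using hhead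
      · simpa only [Pi.add_apply] using congr_fun htail i

/-- Products: from maps reflecting three-fold sums on `K₁` (sums `< N₁`) and `K₂` (sums `< N₂`),
the map `x ↦ ψ₁ x.1 + N₁ ψ₂ x.2` on `K₁ × K₂` reflects three-fold sums, with sums `< N₁ N₂`
(the same mixed-radix step). [cite: Pratt2024, Thm. 4.7 (proof)] -/
theorem exists_freiman3_prod {K₁ K₂ : Type*} [AddCommGroup K₁] [AddCommGroup K₂] {N₁ N₂ : ℕ}
    {ψ₁ : K₁ → ℕ} {ψ₂ : K₂ → ℕ} (h₁ : ∀ a b c, ψ₁ a + ψ₁ b + ψ₁ c < N₁)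
    (h₁' : ∀ a b c a' b' c', ψ₁ a + ψ₁ b + ψ₁ c = ψ₁ a' + ψ₁ b' + ψ₁ c' →
      a + b + c = a' + b' + c')
    (h₂ : ∀ a b c, ψ₂ a + ψ₂ b + ψ₂ c < N₂)
    (h₂' : ∀ a b c a' b' c', ψ₂ a + ψ₂ b + ψ₂ c = ψ₂ a' + ψ₂ b' + ψ₂ c' →
      a + b + c = a' + b' + c') :
    ∃ ψ : K₁ × K₂ → ℕ, (∀ a b c, ψ a + ψ b + ψ c < N₁ * N₂) ∧
      (∀ a b c a' b' c', ψ a + ψ b + ψ c = ψ a' + ψ b' + ψ c' →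
        a + b + c = a' + b' + c') := by
  have key : ∀ x y z : K₁ × K₂,
      ψ₁ x.1 + N₁ * ψ₂ x.2 + (ψ₁ y.1 + N₁ * ψ₂ y.2) + (ψ₁ z.1 + N₁ * ψ₂ z.2) =
      (ψ₁ x.1 + ψ₁ y.1 + ψ₁ z.1) + N₁ * (ψ₂ x.2 + ψ₂ y.2 + ψ₂ z.2) := by
    intro x y z; ring
  have hN₁ : 0 < N₁ := by have := h₁ 0 0 0; omega
  refine ⟨fun x => ψ₁ x.1 + N₁ * ψ₂ x.2, fun a b c => ?_, fun a b c a' b' c' h => ?_⟩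
  · rw [key]
    have hA := h₁ a.1 b.1 c.1
    have hB := h₂ a.2 b.2 c.2
    calc ψ₁ a.1 + ψ₁ b.1 + ψ₁ c.1 + N₁ * (ψ₂ a.2 + ψ₂ b.2 + ψ₂ c.2)
        < N₁ + N₁ * (ψ₂ a.2 + ψ₂ b.2 + ψ₂ c.2) := Nat.add_lt_add_right hA _
      _ = N₁ * (ψ₂ a.2 + ψ₂ b.2 + ψ₂ c.2 + 1) := by ring
      _ ≤ N₁ * N₂ := Nat.mul_le_mul_left _ (Nat.succ_le_of_lt hB)
  · rw [key, key] at h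
    have hV := h₁ a.1 b.1 c.1
    have hV' := h₁ a'.1 b'.1 c'.1
    have hmod := congrArg (· % N₁) h
    have hdiv := congrArg (· / N₁) h
    simp only [Nat.add_mul_mod_self_left, Nat.mod_eq_of_lt hV, Nat.mod_eq_of_lt hV'] at hmod
    simp only [Nat.add_mul_div_left _ _ hN₁, Nat.div_eq_of_lt hV, Nat.div_eq_of_lt hV',
      zero_add] at hdiv
    exact Prod.ext (by simpa using h₁' _ _ _ _ _ _ hmod) (by simpa using h₂' _ _ _ _ _ _ hdiv)

end Freiman

/-! ### Assembly: an STPP family in `K` (or `K³`) bounds `Val(ℤ_N)` from below -/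

section ToZMod

variable {K : Type*} [AddCommGroup K] {ι : Type*} [Fintype ι]

/-- An STPP family in `K` and an ℕ-valued map on `K` reflecting three-fold sums, with all such
sums `< N`, give `Σᵢ |Aᵢ||Bᵢ||Cᵢ| ≤ Val(ℤ/Nℤ)` (transport along `x ↦ ψ x mod N`, which still
reflects three-fold sums, then Prop. 3.3): the two displayed conclusions of the proof of
Pratt's Thm. 4.7, "the image of sets satisfying the STPP under this map still satisfy the STPP.
This shows that `Val(G') > …`". [cite: Pratt2024, Thm. 4.7 (proof)] -/
theorem sum_card_mul_le_prattVal_zmod_of_reflect {A B C : ι → Finset K}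
    (hS : AddSimultaneousTPP A B C) {N : ℕ} [NeZero N] {ψ : K → ℕ}
    (h₁ : ∀ a b c, ψ a + ψ b + ψ c < N)
    (h₂ : ∀ a b c a' b' c', ψ a + ψ b + ψ c = ψ a' + ψ b' + ψ c' → a + b + c = a' + b' + c') :
    ∑ i, #(A i) * #(B i) * #(C i) ≤ prattVal (ZMod N) := by
  set φ : K → ZMod N := fun x => ((ψ x : ℕ) : ZMod N) with hφ
  have hφr : ∀ a b c a' b' c', φ a + φ b + φ c = φ a' + φ b' + φ c' →
      a + b + c = a' + b' + c' := by
    intro a b c a' b' c' h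
    apply h₂
    have h' : ((ψ a + ψ b + ψ c : ℕ) : ZMod N) = ((ψ a' + ψ b' + ψ c' : ℕ) : ZMod N) := by
      push_cast; exact h
    rwa [ZMod.natCast_eq_natCast_iff', Nat.mod_eq_of_lt (h₁ _ _ _),
      Nat.mod_eq_of_lt (h₁ _ _ _)] at h'
  have hinj := injective_of_reflect φ hφr
  have h := sum_card_mul_le_prattVal_of_addSimultaneousTPP
    (addSimultaneousTPP_image_of_reflect hS φ hφr)
  simpa only [card_image_of_injective _ hinj] using h

/-- The mixed-radix map for a group given with a decomposition `K ≃ ∏_{i<k} ℤ/mᵢ`: an ℕ-valued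
map reflecting three-fold sums, with sums `< 3^k ∏ mᵢ = 3^k |K|`.
[cite: Pratt2024, Thm. 4.7 (proof)] -/
theorem exists_freiman3_of_addEquiv {k : ℕ} {m : Fin k → ℕ} (hm : ∀ i, 0 < m i)
    (e : K ≃+ Π i, ZMod (m i)) :
    ∃ ψ : K → ℕ, (∀ a b c, ψ a + ψ b + ψ c < 3 ^ k * ∏ i, m i) ∧
      (∀ a b c a' b' c', ψ a + ψ b + ψ c = ψ a' + ψ b' + ψ c' →
        a + b + c = a' + b' + c') := by
  obtain ⟨ψ, h1, h2⟩ := exists_freiman3_pi_zmod k m hm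
  refine ⟨ψ ∘ e, fun a b c => h1 _ _ _, fun a b c a' b' c' h => e.injective ?_⟩
  simpa only [map_add] using h2 _ _ _ _ _ _ h

/-- The mixed-radix map for `K × K × K` with `K ≃ ∏_{i<k} ℤ/mᵢ` (Pratt's `G³ = ℤ_{m₁} × ⋯ × ℤ_{m_k}`
in the proof of Thm. 4.7): sums `< (3^k |K|)^3`. [cite: Pratt2024, Thm. 4.7 (proof)] -/
theorem exists_freiman3_triple_of_addEquiv {k : ℕ} {m : Fin k → ℕ} (hm : ∀ i, 0 < m i)
    (e : K ≃+ Π i, ZMod (m i)) :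
    ∃ ψ : K × K × K → ℕ, (∀ a b c, ψ a + ψ b + ψ c < (3 ^ k * ∏ i, m i) ^ 3) ∧
      (∀ a b c a' b' c', ψ a + ψ b + ψ c = ψ a' + ψ b' + ψ c' →
        a + b + c = a' + b' + c') := by
  obtain ⟨ψ, h1, h2⟩ := exists_freiman3_of_addEquiv hm e
  obtain ⟨ψ₂, g1, g2⟩ := exists_freiman3_prod h1 h2 h1 h2
  obtain ⟨ψ₃, f1, f2⟩ := exists_freiman3_prod h1 h2 g1 g2
  exact ⟨ψ₃, fun a b c => by rw [pow_three]; exact f1 a b c, f2⟩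

/-- **The transfer of the proof of Pratt's Thm. 4.7, assembled**: an STPP family
`(Aᵥ, Bᵥ, Cᵥ)ᵥ` in `K³`, where `K ≃ ∏_{i<k} ℤ/mᵢ`, yields `Σᵥ |Aᵥ||Bᵥ||Cᵥ| ≤ Val(ℤ/Nℤ)` for
every `N ≥ (3^k |K|)^3` (the printed `N = ∏ᵢ 3mᵢ` over the factors of `G³`; any larger modulus
works since the mixed-radix sums stay below it). [cite: Pratt2024, Thm. 4.7 (proof)] -/
theorem sum_card_mul_le_prattVal_zmod_of_addEquiv {A B C : ι → Finset (K × K × K)}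
    (hS : AddSimultaneousTPP A B C) {k : ℕ} {m : Fin k → ℕ} (hm : ∀ i, 0 < m i)
    (e : K ≃+ Π i, ZMod (m i)) {N : ℕ} [NeZero N] (hN : (3 ^ k * ∏ i, m i) ^ 3 ≤ N) :
    ∑ i, #(A i) * #(B i) * #(C i) ≤ prattVal (ZMod N) := by
  obtain ⟨ψ, h1, h2⟩ := exists_freiman3_triple_of_addEquiv hm e
  exact sum_card_mul_le_prattVal_zmod_of_reflect hS (fun a b c => (h1 a b c).trans_le hN) h2

end ToZMod

end Literature.Computability.AlgebraicComplexity
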